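import Summits.HubbardSuperconductivity.HubbardSuperconductivity.Theorems.AnisotropyChordTransferFibre3RowCShellWinLemmas
import Summits.HubbardSuperconductivity.HubbardSuperconductivity.Theorems.AnisotropyChordTransferFibre3RowCShellWinSites
import Summits.HubbardSuperconductivity.HubbardSuperconductivity.Theorems.AnisotropyChordTransferFibre3RowCTShellWinLemmas

/-!
# Route `AnisotropyChord` / H0 rotor rung, row C (KT-2b) on the t-BLOCKS `64 ≤ L < 128`: block twin of `…AnisotropyChordTransferFibre3RowCShellWinSites`

T-FORK (p1 g32, route-lead ruling R4-b; p2's inventory memo HOME/hubbard-h0-rotor-p2/TBLOCK-INVENTORY-g8.md §3–§4): the declarations of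
`…RowCShellWinSites` that carry the hypothesis `128 ≤ L` (or a constant that changes below `L = 128`, or the `L2.NamedCell` cell box) restated in the
namespace `RowC.T` with the SAME names for the t-blocks (route-lead ruling R1): analytic layer with `64 ≤ L` and the `L ≥ 64` numerics of p2 g8
(`ManifoldA.nu_ceiling64` (ν < .0359), `manifold_band64`, `second_shell_window64` (±.0012/±.003), `RowC.fmax_uniform64`/`gmin_uniform64`
(same constant .07 + .1ν), `third_shell_window64` (±.0031/±.01), `window_k10_64` ([.24993, .25]), `lam_increment_bound64` (δ = .0022)); cell layer on
block cells `c : L2.TCell` (`cellFinalBoxCB (c.box a₁ a₂)`, `pmem_xTrueT`, `RowC.finalVec_mem_of_cellFinalBoxT`).  Declarations that do not change are NOT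
duplicated (they resolve to `RowC`); proofs are verbatim up to the substitutions.
Prover seat `hubbard-h0-rotor-p1` g32 (route lead); helper for piece A = stmt-HubbardSuperconductivity-23918 of rung 19089 (`--supports`, helper
class).  Nothing here proves superconductivity in the Hubbard model; lemmas for ONE row of ONE conditional reduction on the t-blocks; the rotor TARGET
as originally worded stays FALSE (g15 verdict).  Mathlib + the tree only; no sorry.
-/

set_option linter.dupNamespace false
set_option autoImplicit false

open Finset

open scoped BigOperators

namespace Summit.HubbardSuperconductivity.HubbardSuperconductivity.Theorems.AnisotropyChord.Transfer.Fibre3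

namespace RowC

namespace T

variable (L : ℕ) [NeZero L]

/-- the ground profile on the 22 integer sites of the window shell: `f(site) = a + c_s·a_λ(canonical site)` (lattice symmetry
`f(−x,y) = f(x,−y) = f(y,x) = f(x,y)` of the ground profile and `f = a + c_s a_λ` off the origin), and `f(0,0) = 0`. [folklore] -/
theorem site_values (hL : 64 ≤ L) {Δ lam2 : ℝ} {f : Tor L → ℝ} (hΔ0 : 0 ≤ Δ) (hΔ1 : Δ < 1)
    (hf : IsGroundTwoMagnon L Δ lam2 f) :
    f (B1.toTor L ((1 : ℤ), (0 : ℤ))) = Δ * f (K1 L) + cS L Δ lam2 f * aKer L lam2 (B1.toTor L ((1 : ℤ), (0 : ℤ))) ∧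
    f (B1.toTor L ((-1 : ℤ), (0 : ℤ))) = Δ * f (K1 L) + cS L Δ lam2 f * aKer L lam2 (B1.toTor L ((1 : ℤ), (0 : ℤ))) ∧
    f (B1.toTor L ((0 : ℤ), (1 : ℤ))) = Δ * f (K1 L) + cS L Δ lam2 f * aKer L lam2 (B1.toTor L ((1 : ℤ), (0 : ℤ))) ∧
    f (B1.toTor L ((0 : ℤ), (-1 : ℤ))) = Δ * f (K1 L) + cS L Δ lam2 f * aKer L lam2 (B1.toTor L ((1 : ℤ), (0 : ℤ))) ∧
    f (B1.toTor L ((2 : ℤ), (0 : ℤ))) = Δ * f (K1 L) + cS L Δ lam2 f * aKer L lam2 (B1.toTor L ((2 : ℤ), (0 : ℤ))) ∧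
    f (B1.toTor L ((-2 : ℤ), (0 : ℤ))) = Δ * f (K1 L) + cS L Δ lam2 f * aKer L lam2 (B1.toTor L ((2 : ℤ), (0 : ℤ))) ∧
    f (B1.toTor L ((0 : ℤ), (2 : ℤ))) = Δ * f (K1 L) + cS L Δ lam2 f * aKer L lam2 (B1.toTor L ((2 : ℤ), (0 : ℤ))) ∧
    f (B1.toTor L ((0 : ℤ), (-2 : ℤ))) = Δ * f (K1 L) + cS L Δ lam2 f * aKer L lam2 (B1.toTor L ((2 : ℤ), (0 : ℤ))) ∧
    f (B1.toTor L ((1 : ℤ), (1 : ℤ))) = Δ * f (K1 L) + cS L Δ lam2 f * aKer L lam2 (B1.toTor L ((1 : ℤ), (1 : ℤ))) ∧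
    f (B1.toTor L ((-1 : ℤ), (1 : ℤ))) = Δ * f (K1 L) + cS L Δ lam2 f * aKer L lam2 (B1.toTor L ((1 : ℤ), (1 : ℤ))) ∧
    f (B1.toTor L ((1 : ℤ), (-1 : ℤ))) = Δ * f (K1 L) + cS L Δ lam2 f * aKer L lam2 (B1.toTor L ((1 : ℤ), (1 : ℤ))) ∧
    f (B1.toTor L ((-1 : ℤ), (-1 : ℤ))) = Δ * f (K1 L) + cS L Δ lam2 f * aKer L lam2 (B1.toTor L ((1 : ℤ), (1 : ℤ))) ∧
    f (B1.toTor L ((2 : ℤ), (1 : ℤ))) = Δ * f (K1 L) + cS L Δ lam2 f * aKer L lam2 (B1.toTor L ((2 : ℤ), (1 : ℤ))) ∧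
    f (B1.toTor L ((-2 : ℤ), (1 : ℤ))) = Δ * f (K1 L) + cS L Δ lam2 f * aKer L lam2 (B1.toTor L ((2 : ℤ), (1 : ℤ))) ∧
    f (B1.toTor L ((2 : ℤ), (-1 : ℤ))) = Δ * f (K1 L) + cS L Δ lam2 f * aKer L lam2 (B1.toTor L ((2 : ℤ), (1 : ℤ))) ∧
    f (B1.toTor L ((-2 : ℤ), (-1 : ℤ))) = Δ * f (K1 L) + cS L Δ lam2 f * aKer L lam2 (B1.toTor L ((2 : ℤ), (1 : ℤ))) ∧
    f (B1.toTor L ((1 : ℤ), (2 : ℤ))) = Δ * f (K1 L) + cS L Δ lam2 f * aKer L lam2 (B1.toTor L ((2 : ℤ), (1 : ℤ))) ∧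
    f (B1.toTor L ((-1 : ℤ), (2 : ℤ))) = Δ * f (K1 L) + cS L Δ lam2 f * aKer L lam2 (B1.toTor L ((2 : ℤ), (1 : ℤ))) ∧
    f (B1.toTor L ((1 : ℤ), (-2 : ℤ))) = Δ * f (K1 L) + cS L Δ lam2 f * aKer L lam2 (B1.toTor L ((2 : ℤ), (1 : ℤ))) ∧
    f (B1.toTor L ((-1 : ℤ), (-2 : ℤ))) = Δ * f (K1 L) + cS L Δ lam2 f * aKer L lam2 (B1.toTor L ((2 : ℤ), (1 : ℤ))) ∧
    f (B1.toTor L ((3 : ℤ), (0 : ℤ))) = Δ * f (K1 L) + cS L Δ lam2 f * aKer L lam2 (B1.toTor L ((3 : ℤ), (0 : ℤ))) ∧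
    f (B1.toTor L ((-3 : ℤ), (0 : ℤ))) = Δ * f (K1 L) + cS L Δ lam2 f * aKer L lam2 (B1.toTor L ((3 : ℤ), (0 : ℤ))) ∧
    f (B1.toTor L ((0 : ℤ), (0 : ℤ))) = 0 := by
  have hL2 : 2 ≤ L := by omega
  have hLi : (64 : ℤ) ≤ L := by exact_mod_cast hL
  obtain ⟨_, _, hval, _, _⟩ := window_dictionary L hL hΔ0 hΔ1 hf
  have fs := f_toTor_symm L hf.2.1 (ground_mirror L hL2 hf) (ground_swap L hL2 hf)
  have n10 : B1.toTor L ((1 : ℤ), (0 : ℤ)) ≠ 0 := toTor_ne_zero_fst L one_ne_zero (by simp only [abs_one]; omega)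
  have n11 : B1.toTor L ((1 : ℤ), (1 : ℤ)) ≠ 0 := toTor_ne_zero_fst L one_ne_zero (by simp only [abs_one]; omega)
  have n20 : B1.toTor L ((2 : ℤ), (0 : ℤ)) ≠ 0 := toTor_ne_zero_fst L two_ne_zero (by rw [abs_of_pos (by norm_num : (0:ℤ) < 2)]; omega)
  have n21 : B1.toTor L ((2 : ℤ), (1 : ℤ)) ≠ 0 := toTor_ne_zero_fst L two_ne_zero (by rw [abs_of_pos (by norm_num : (0:ℤ) < 2)]; omega)
  have n30 : B1.toTor L ((3 : ℤ), (0 : ℤ)) ≠ 0 := toTor_ne_zero_fst L three_ne_zero (by rw [abs_of_pos (by norm_num : (0:ℤ) < 3)]; omega)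
  have z00 : B1.toTor L ((0 : ℤ), (0 : ℤ)) = 0 := by unfold B1.toTor; simp
  refine ⟨?_, ?_, ?_, ?_, ?_, ?_, ?_, ?_, ?_, ?_, ?_, ?_, ?_, ?_, ?_, ?_, ?_, ?_, ?_, ?_, ?_, ?_, ?_⟩
  · rw [hval _ n10]
  · rw [(fs 1 0).1, hval _ n10]
  · rw [(fs 1 0).2.2, hval _ n10]
  · rw [(fs 0 1).2.1, (fs 1 0).2.2, hval _ n10]
  · rw [hval _ n20]
  · rw [(fs 2 0).1, hval _ n20]
  · rw [(fs 2 0).2.2, hval _ n20]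
  · rw [(fs 0 2).2.1, (fs 2 0).2.2, hval _ n20]
  · rw [hval _ n11]
  · rw [(fs 1 1).1, hval _ n11]
  · rw [(fs 1 1).2.1, hval _ n11]
  · rw [(fs 1 (-1)).1, (fs 1 1).2.1, hval _ n11]
  · rw [hval _ n21]
  · rw [(fs 2 1).1, hval _ n21]
  · rw [(fs 2 1).2.1, hval _ n21]
  · rw [(fs 2 (-1)).1, (fs 2 1).2.1, hval _ n21]
  · rw [(fs 2 1).2.2, hval _ n21]
  · rw [(fs 1 2).1, (fs 2 1).2.2, hval _ n21]
  · rw [(fs 1 2).2.1, (fs 2 1).2.2, hval _ n21]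
  · rw [(fs 1 (-2)).1, (fs 1 2).2.1, (fs 2 1).2.2, hval _ n21]
  · rw [hval _ n30]
  · rw [(fs 3 0).1, hval _ n30]
  · rw [z00, hf.1.1]


/-- the window numbers multiplied through by `c_s ≥ 0` (the linear facts the slot bounds are closed with). [folklore] -/
theorem site_numbers (hL : 64 ≤ L) {Δ lam2 : ℝ} {f : Tor L → ℝ} (hΔ0 : 0 ≤ Δ) (hΔ1 : Δ < 1)
    (hf : IsGroundTwoMagnon L Δ lam2 f) :
    0 ≤ cS L Δ lam2 f ∧
    0 ≤ Δ * f (K1 L) ∧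
    f (K1 L) = Δ * f (K1 L) + cS L Δ lam2 f * aKer L lam2 (B1.toTor L ((1 : ℤ), (0 : ℤ))) ∧
    0.115 * cS L Δ lam2 f ≤ f (K1 L) ∧
    cS L Δ lam2 f * 0.24993 ≤ cS L Δ lam2 f * aKer L lam2 (B1.toTor L ((1 : ℤ), (0 : ℤ))) ∧
    cS L Δ lam2 f * aKer L lam2 (B1.toTor L ((1 : ℤ), (0 : ℤ))) ≤ cS L Δ lam2 f * 0.25 ∧
    cS L Δ lam2 f * 0.3171 ≤ cS L Δ lam2 f * aKer L lam2 (B1.toTor L ((1 : ℤ), (1 : ℤ))) ∧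
    cS L Δ lam2 f * aKer L lam2 (B1.toTor L ((1 : ℤ), (1 : ℤ))) ≤ cS L Δ lam2 f * 0.3196 ∧
    cS L Δ lam2 f * 0.3603 ≤ cS L Δ lam2 f * aKer L lam2 (B1.toTor L ((2 : ℤ), (0 : ℤ))) ∧
    cS L Δ lam2 f * aKer L lam2 (B1.toTor L ((2 : ℤ), (0 : ℤ))) ≤ cS L Δ lam2 f * 0.3664 ∧
    cS L Δ lam2 f * 0.3835 ≤ cS L Δ lam2 f * aKer L lam2 (B1.toTor L ((2 : ℤ), (1 : ℤ))) ∧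
    cS L Δ lam2 f * aKer L lam2 (B1.toTor L ((2 : ℤ), (1 : ℤ))) ≤ cS L Δ lam2 f * 0.3898 ∧
    cS L Δ lam2 f * 0.4202 ≤ cS L Δ lam2 f * aKer L lam2 (B1.toTor L ((3 : ℤ), (0 : ℤ))) ∧
    cS L Δ lam2 f * aKer L lam2 (B1.toTor L ((3 : ℤ), (0 : ℤ))) ≤ cS L Δ lam2 f * 0.4403 := by
  obtain ⟨hc0, ha0, _, hF, hgF⟩ := window_dictionary L hL hΔ0 hΔ1 hf
  obtain ⟨k10l, k10u⟩ := window_k10_64 L hL hΔ0 hΔ1 hf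
  obtain ⟨⟨k11l, k11u⟩, ⟨k20l, k20u⟩⟩ := window_k11_k20' L hL hΔ0 hΔ1 hf
  obtain ⟨⟨k21l, k21u⟩, ⟨k30l, k30u⟩⟩ := window_k21_k30 L hL hΔ0 hΔ1 hf
  exact ⟨hc0, ha0, hF, hgF,
    mul_le_mul_of_nonneg_left k10l hc0, mul_le_mul_of_nonneg_left k10u hc0,
    mul_le_mul_of_nonneg_left k11l hc0, mul_le_mul_of_nonneg_left k11u hc0,
    mul_le_mul_of_nonneg_left k20l hc0, mul_le_mul_of_nonneg_left k20u hc0,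
    mul_le_mul_of_nonneg_left k21l hc0, mul_le_mul_of_nonneg_left k21u hc0,
    mul_le_mul_of_nonneg_left k30l hc0, mul_le_mul_of_nonneg_left k30u hc0⟩


end T

end RowC

end Summit.HubbardSuperconductivity.HubbardSuperconductivity.Theorems.AnisotropyChord.Transfer.Fibre3
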